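import Summits.Parity.BatemanHorn.Theorems.IsogenyRedeiPencilSelmerDictionaryGlue
import Summits.Parity.BatemanHorn.Theorems.IsogenyRedeiPencilSelmerDictionaryBSideOddPlaces
import Summits.Parity.BatemanHorn.Theorems.IsogenyRedeiPencilSelmerDictionaryDualSideOddPlaces
import Summits.Parity.BatemanHorn.Theorems.IsogenyRedeiPencilSelmerDictionaryBSideTwoAdic
import Summits.Parity.BatemanHorn.Theorems.IsogenyRedeiPencilSelmerDictionaryDualSideTwoAdic
import Summits.Parity.BatemanHorn.Theorems.IsogenyRedeiPencilSelmerDictionaryKernelCount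
import HarnessLib

/-!
# Route IsogenyRedei, crux `PencilSelmerDictionary` (stmt-Parity-11584): the dictionary modulo
# Cassels' formula (line `toric-node-vacuity-cassels`, all local stubs landed)

`Summit.Parity.BatemanHorn.Theses.IsogenyRedei.PencilSelmerDictionary`:
`∃ M, ∃ w : ℕ → ℤ, (∀ t, w (t + 2^M) = w t) ∧ ∀ t ≥ 1,
(-1)^{corank_{ℤ₂} Sel_{2^∞}(E_t/ℚ)} = -(w t · (-1)^{#odd p ∣ t²+1})`, `E_t = ⟨0, 2t, 0, t²+1, 0⟩`.

The five local statements of the line are theorems of the sibling files (A `stub_bSideOddPlaces`,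
B `stub_dualSideOddPlaces`, C `stub_bSideTwoAdic`, D `stub_dualSideTwoAdic`, E `stub_twoAdicKernelCount`);
the glue `dictionary_of_localData` is proved in `…Glue.lean`. The only remaining input is Cassels'
formula for the `2`-isogeny in parity form — the tree's named fact
`Literature.NumberTheory.EllipticCurves.cassels_selmerCorank_two_parity` (Dokchitser–Dokchitser 2011
§5; Cassels 1965 VIII; Klagsbrun 2016 Thm 3.5–3.6), taken here as a hypothesis: the theorem below is
CONDITIONAL on exactly that fact (D-0014) and becomes the unconditional proof of the crux the day
`cassels_selmerCorank_two_parity_holds` lands (append `PencilSelmerDictionary_proof`). Witness: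
`M = 2`, `w t = if t % 4 < 2 then -1 else 1` (the disprover's forced period-4 table).

[cite: DokchitserDokchitser2011Crelle, §5 (arXiv:0906.1815 Thm. 30)]
-/

noncomputable section

open scoped Classical

namespace Summit.Parity.BatemanHorn.Theorems.PencilSelmerDictionary

open Literature.NumberTheory.EllipticCurves
open Summit.Parity.BatemanHorn.Theses.IsogenyRedei (PencilSelmerDictionary)

/-- **`PencilSelmerDictionary` modulo Cassels' formula.** Granted the named fact
`cassels_selmerCorank_two_parity` (Cassels' formula for a rational `2`-isogeny in parity form), the
crux `PencilSelmerDictionary` holds, with `M = 2` and `w t = if t % 4 < 2 then −1 else 1`: the five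
local statements are the landed theorems A–E of the line, composed by `dictionary_of_localData`.
[cite: DokchitserDokchitser2011Crelle, §5 (arXiv:0906.1815 Thm. 30)] -/
theorem PencilSelmerDictionary_of_cassels :
    cassels_selmerCorank_two_parity → PencilSelmerDictionary := by
  intro hF
  refine ⟨2, fun t => if t % 4 < 2 then -1 else 1, fun t => ?_, fun t ht => ?_⟩
  · show (if (t + 2 ^ 2) % 4 < 2 then (-1 : ℤ) else 1) = if t % 4 < 2 then -1 else 1
    rw [show (t + 2 ^ 2) % 4 = t % 4 by norm_num]
  · exact dictionary_of_localData stub_bSideOddPlaces stub_dualSideOddPlaces stub_bSideTwoAdic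
      stub_dualSideTwoAdic stub_twoAdicKernelCount (casselsPencil_of_fact hF) t ht

end Summit.Parity.BatemanHorn.Theorems.PencilSelmerDictionary

end
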